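import Summits.Ventures.YMGap.RobustBall.MassGapOnBallS
import HarnessLib

/-!
# Venture YMGap, track ROBUST-BALL (tier 2) — closure properties of the weighted ball: sums, scalings,
# convexity, weaker weights

HONEST FRAMING. WHAT THIS IS: a venture file (cell `pub-ymgap`, track Y2 ROBUST-BALL, seat rb-p1): STRUCTURE of
the tier-2 ball `MemBallZdS a Λ t` of `MassGapOnBallS.lean`. The loads are (sub)additive and homogeneous, so:
`W₁ ∈ Ball(a₁, Λ₁, t)`, `W₂ ∈ Ball(a₂, Λ₂, t)` `⇒ W₁ + W₂ ∈ Ball(a₁ + a₂, Λ₁ + Λ₂, t)` (`MemBallZdS.add`);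
`c • W ∈ Ball(|c| a, |c| Λ, t)` (`MemBallZdS.smul`); a smaller weight is cheaper, `t' ≤ t ⇒ Ball(a, Λ, t) ⊆
Ball(a, Λ, t')` (`MemBallZdS.weight_mono`); hence each `Ball(a, Λ, t)` is CONVEX and star-shaped about the
Wilson centre `0` (`MemBallZdS.convex`, `MemBallZdS.smul_of_abs_le_one`). Consequence: the exhibited members
(adjoint plaquette terms, axial / isotropic / general two-plaquette couplings) may be superposed inside one
certified row by adding their loads. WHAT IT IS NOT: no measure-theoretic content, no number; nothing about
the continuum limit or the Clay problem.

References: `MassGapOnBallS.lean` (this track); Georgii (2011) §2.1 (Banach space of potentials).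
-/

noncomputable section

open MeasureTheory Filter Function Topology Real
open Literature.Probability.LatticeModels
open Literature.Probability.LatticeModels.DobrushinMetric
open Literature.MathematicalPhysics.QuantumLattice
open Literature.MathematicalPhysics.QuantumFieldTheory hiding ZdEdge

namespace Summit.Ventures.YMGap.RobustBall

variable {d N : ℕ}

/-! ### One-link witnesses of sums and multiples -/

section Witnesses

variable {V S : Type*}

/-- Oscillation witnesses add. -/
theorem isOscBound_add {f g : (V → S) → ℝ} {δ δ' : V → ℝ} (hf : Dobrushin.IsOscBound f δ)
    (hg : Dobrushin.IsOscBound g δ') : Dobrushin.IsOscBound (f + g) (δ + δ') := by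
  refine ⟨fun y => add_nonneg (hf.nonneg y) (hg.nonneg y), fun y σ τ h => ?_⟩
  simp only [Pi.add_apply]
  calc |f σ + g σ - (f τ + g τ)| = |(f σ - f τ) + (g σ - g τ)| := by ring_nf
    _ ≤ |f σ - f τ| + |g σ - g τ| := abs_add_le _ _
    _ ≤ δ y + δ' y := add_le_add (hf.le y σ τ h) (hg.le y σ τ h)

/-- Oscillation witnesses scale by `|c|`. -/
theorem isOscBound_smul {f : (V → S) → ℝ} {δ : V → ℝ} (hf : Dobrushin.IsOscBound f δ) (c : ℝ) :
    Dobrushin.IsOscBound (c • f) (fun y => |c| * δ y) := by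
  refine ⟨fun y => mul_nonneg (abs_nonneg c) (hf.nonneg y), fun y σ τ h => ?_⟩
  simp only [Pi.smul_apply, smul_eq_mul]
  rw [← mul_sub, abs_mul]
  exact mul_le_mul_of_nonneg_left (hf.le y σ τ h) (abs_nonneg c)

/-- Lipschitz witnesses add. -/
theorem isLipBound_add {r : S → S → ℝ} {f g : (V → S) → ℝ} {δ δ' : V → ℝ} (hf : IsLipBound r f δ)
    (hg : IsLipBound r g δ') : IsLipBound r (f + g) (δ + δ') := by
  refine ⟨fun y => add_nonneg (hf.nonneg y) (hg.nonneg y), fun y σ τ h => ?_⟩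
  simp only [Pi.add_apply]
  calc |f σ + g σ - (f τ + g τ)| = |(f σ - f τ) + (g σ - g τ)| := by ring_nf
    _ ≤ |f σ - f τ| + |g σ - g τ| := abs_add_le _ _
    _ ≤ δ y * r (σ y) (τ y) + δ' y * r (σ y) (τ y) := add_le_add (hf.le y σ τ h) (hg.le y σ τ h)
    _ = (δ y + δ' y) * r (σ y) (τ y) := by ring

/-- Lipschitz witnesses scale by `|c|`. -/
theorem isLipBound_smul {r : S → S → ℝ} {f : (V → S) → ℝ} {δ : V → ℝ} (hf : IsLipBound r f δ) (c : ℝ) :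
    IsLipBound r (c • f) (fun y => |c| * δ y) := by
  refine ⟨fun y => mul_nonneg (abs_nonneg c) (hf.nonneg y), fun y σ τ h => ?_⟩
  simp only [Pi.smul_apply, smul_eq_mul]
  rw [← mul_sub, abs_mul, mul_assoc]
  exact mul_le_mul_of_nonneg_left (hf.le y σ τ h) (abs_nonneg c)

end Witnesses

/-! ### The ball is closed under sums -/

section Closure

variable {a₁ a₂ Λ₁ Λ₂ a Λ t t' : ℝ} {W W₁ W₂ : Potential (ZdEdge d) (Matrix.specialUnitaryGroup (Fin N) ℂ)}

/-- Summable link majorants add. -/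
theorem IsLinkSummable.add {B₁ B₂ : Finset (ZdEdge d) → ℝ} (h₁ : IsLinkSummable W₁ B₁) (h₂ : IsLinkSummable W₂ B₂) :
    IsLinkSummable (W₁ + W₂) (B₁ + B₂) := by
  refine ⟨fun X U => ?_, fun e => ?_⟩
  · simp only [Pi.add_apply]
    exact (abs_add_le _ _).trans (add_le_add (h₁.abs_le X U) (h₂.abs_le X U))
  · have h := (h₁.summable e).add (h₂.summable e)
    refine h.congr fun X => ?_
    simp only [Pi.add_apply]
    split_ifs <;> ring

/-- Summable link majorants scale. -/
theorem IsLinkSummable.smul {B : Finset (ZdEdge d) → ℝ} (h : IsLinkSummable W B) (c : ℝ) :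
    IsLinkSummable (c • W) (fun X => |c| * B X) := by
  refine ⟨fun X U => ?_, fun e => ?_⟩
  · simp only [Pi.smul_apply, smul_eq_mul, abs_mul]
    exact mul_le_mul_of_nonneg_left (h.abs_le X U) (abs_nonneg c)
  · refine ((h.summable e).mul_left |c|).congr fun X => ?_
    split_ifs <;> ring

/-- **THE BALL IS CLOSED UNDER SUMS, loads adding**: `W₁ ∈ Ball(a₁, Λ₁, t)`, `W₂ ∈ Ball(a₂, Λ₂, t)` give
`W₁ + W₂ ∈ Ball(a₁ + a₂, Λ₁ + Λ₂, t)`. -/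
theorem MemBallZdS.add (h₁ : MemBallZdS a₁ Λ₁ t W₁) (h₂ : MemBallZdS a₂ Λ₂ t W₂) :
    MemBallZdS (a₁ + a₂) (Λ₁ + Λ₂) t (W₁ + W₂) := by
  obtain ⟨B₁, hB₁⟩ := h₁.summable
  obtain ⟨B₂, hB₂⟩ := h₂.summable
  obtain ⟨osc₁, lip₁, ℓ₁, ho₁, hl₁, hos₁, hoa₁, hls₁, hlℓ₁, hws₁, hwΛ₁⟩ := h₁.loads
  obtain ⟨osc₂, lip₂, ℓ₂, ho₂, hl₂, hos₂, hoa₂, hls₂, hlℓ₂, hws₂, hwΛ₂⟩ := h₂.loads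
  refine ⟨fun X => ?_, fun X => ?_, ⟨B₁ + B₂, hB₁.add hB₂⟩, osc₁ + osc₂, lip₁ + lip₂, ℓ₁ + ℓ₂,
    fun X => ?_, fun X => ?_, fun e => ?_, fun e => ?_, fun e y => ?_, fun e y hye => ?_, fun e => ?_, fun e => ?_⟩
  · simpa only [Pi.add_apply] using (h₁.continuous X).add (h₂.continuous X)
  · intro U V hUV
    simp only [Pi.add_apply]
    rw [h₁.dependsOn X hUV, h₂.dependsOn X hUV]
  · simpa only [Pi.add_apply] using isOscBound_add (ho₁ X) (ho₂ X)
  · simpa only [Pi.add_apply] using isLipBound_add (hl₁ X) (hl₂ X)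
  · refine ((hos₁ e).add (hos₂ e)).congr fun X => ?_
    simp only [Pi.add_apply]
    split_ifs <;> ring
  · have heq : (fun X : Finset (ZdEdge d) => if e ∈ X then (osc₁ + osc₂) X e else 0) =
        fun X => (if e ∈ X then osc₁ X e else 0) + (if e ∈ X then osc₂ X e else 0) := by
      funext X; simp only [Pi.add_apply]; split_ifs <;> ring
    rw [heq, (hos₁ e).tsum_add (hos₂ e)]
    exact add_le_add (hoa₁ e) (hoa₂ e)
  · refine ((hls₁ e y).add (hls₂ e y)).congr fun X => ?_
    simp only [Pi.add_apply]
    split_ifs <;> ring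
  · have heq : (fun X : Finset (ZdEdge d) => if e ∈ X ∧ y ∈ X then (lip₁ + lip₂) X y else 0) =
        fun X => (if e ∈ X ∧ y ∈ X then lip₁ X y else 0) + (if e ∈ X ∧ y ∈ X then lip₂ X y else 0) := by
      funext X; simp only [Pi.add_apply]; split_ifs <;> ring
    rw [heq, (hls₁ e y).tsum_add (hls₂ e y)]
    simp only [Pi.add_apply]
    exact add_le_add (hlℓ₁ e y hye) (hlℓ₂ e y hye)
  · refine ((hws₁ e).add (hws₂ e)).congr fun y => ?_
    simp only [Pi.add_apply]
    split_ifs <;> ring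
  · have heq : (fun y : ZdEdge d => (if y = e then 0 else (ℓ₁ + ℓ₂) e y) * exp (t * ‖e.1 - y.1‖)) =
        fun y => (if y = e then 0 else ℓ₁ e y) * exp (t * ‖e.1 - y.1‖) +
          (if y = e then 0 else ℓ₂ e y) * exp (t * ‖e.1 - y.1‖) := by
      funext y; simp only [Pi.add_apply]; split_ifs <;> ring
    rw [heq, (hws₁ e).tsum_add (hws₂ e)]
    exact add_le_add (hwΛ₁ e) (hwΛ₂ e)

/-- **THE BALL IS HOMOGENEOUS**: `W ∈ Ball(a, Λ, t)` gives `c • W ∈ Ball(|c| a, |c| Λ, t)`. -/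
theorem MemBallZdS.smul (h : MemBallZdS a Λ t W) (c : ℝ) : MemBallZdS (|c| * a) (|c| * Λ) t (c • W) := by
  obtain ⟨B, hB⟩ := h.summable
  obtain ⟨osc, lip, ℓ, ho, hl, hos, hoa, hls, hlℓ, hws, hwΛ⟩ := h.loads
  have hc := abs_nonneg c
  refine ⟨fun X => ?_, fun X => ?_, ⟨_, hB.smul c⟩, fun X y => |c| * osc X y, fun X y => |c| * lip X y,
    fun e y => |c| * ℓ e y, fun X => ?_, fun X => ?_, fun e => ?_, fun e => ?_, fun e y => ?_, fun e y hye => ?_,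
    fun e => ?_, fun e => ?_⟩
  · simpa only [Pi.smul_apply] using (h.continuous X).const_smul c
  · intro U V hUV
    simp only [Pi.smul_apply, smul_eq_mul]
    rw [h.dependsOn X hUV]
  · simpa only [Pi.smul_apply] using isOscBound_smul (ho X) c
  · simpa only [Pi.smul_apply] using isLipBound_smul (hl X) c
  · refine ((hos e).mul_left |c|).congr fun X => ?_
    split_ifs <;> ring
  · have heq : (fun X : Finset (ZdEdge d) => if e ∈ X then |c| * osc X e else 0) =
        fun X => |c| * (if e ∈ X then osc X e else 0) := by
      funext X; split_ifs <;> ring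
    rw [heq, tsum_mul_left]
    exact mul_le_mul_of_nonneg_left (hoa e) hc
  · refine ((hls e y).mul_left |c|).congr fun X => ?_
    split_ifs <;> ring
  · have heq : (fun X : Finset (ZdEdge d) => if e ∈ X ∧ y ∈ X then |c| * lip X y else 0) =
        fun X => |c| * (if e ∈ X ∧ y ∈ X then lip X y else 0) := by
      funext X; split_ifs <;> ring
    rw [heq, tsum_mul_left]
    exact mul_le_mul_of_nonneg_left (hlℓ e y hye) hc
  · refine ((hws e).mul_left |c|).congr fun y => ?_
    split_ifs <;> ring
  · have heq : (fun y : ZdEdge d => (if y = e then 0 else |c| * ℓ e y) * exp (t * ‖e.1 - y.1‖)) =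
        fun y => |c| * ((if y = e then 0 else ℓ e y) * exp (t * ‖e.1 - y.1‖)) := by
      funext y; split_ifs <;> ring
    rw [heq, tsum_mul_left]
    exact mul_le_mul_of_nonneg_left (hwΛ e) hc

/-- **A SMALLER WEIGHT IS CHEAPER**: `Ball(a, Λ, t) ⊆ Ball(a, Λ, t')` for `t' ≤ t` (the weighted cross load only
decreases). -/
theorem MemBallZdS.weight_mono (h : MemBallZdS a Λ t W) (ht : t' ≤ t) : MemBallZdS a Λ t' W := by
  obtain ⟨osc, lip, ℓ, ho, hl, hos, hoa, hls, hlℓ, hws, hwΛ⟩ := h.loads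
  have hℓ0 : ∀ e y, y ≠ e → 0 ≤ ℓ e y := fun e y hye =>
    le_trans (tsum_nonneg fun X => by split_ifs <;> first | exact (hl X).nonneg y | exact le_rfl) (hlℓ e y hye)
  have hpt : ∀ e y, (if y = e then 0 else ℓ e y) * exp (t' * ‖e.1 - y.1‖) ≤
      (if y = e then 0 else ℓ e y) * exp (t * ‖e.1 - y.1‖) := by
    intro e y
    by_cases hye : y = e
    · simp [hye]
    · rw [if_neg hye]
      exact mul_le_mul_of_nonneg_left (exp_le_exp.2 (mul_le_mul_of_nonneg_right ht (norm_nonneg _))) (hℓ0 e y hye)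
  have hnn : ∀ e y, 0 ≤ (if y = e then 0 else ℓ e y) * exp (t' * ‖e.1 - y.1‖) := by
    intro e y
    by_cases hye : y = e
    · simp [hye]
    · rw [if_neg hye]; exact mul_nonneg (hℓ0 e y hye) (exp_pos _).le
  refine ⟨h.continuous, h.dependsOn, h.summable, osc, lip, ℓ, ho, hl, hos, hoa, hls, hlℓ, fun e => ?_, fun e => ?_⟩
  · exact Summable.of_nonneg_of_le (hnn e) (hpt e) (hws e)
  · exact ((Summable.of_nonneg_of_le (hnn e) (hpt e) (hws e)).tsum_le_tsum (hpt e) (hws e)).trans (hwΛ e)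

/-- **STAR-SHAPED about the Wilson centre**: `|c| ≤ 1` and `W ∈ Ball(a, Λ, t)` (`a, Λ ≥ 0`) give `c • W ∈ Ball(a, Λ, t)`. -/
theorem MemBallZdS.smul_of_abs_le_one (h : MemBallZdS a Λ t W) (ha : 0 ≤ a) (hΛ : 0 ≤ Λ) {c : ℝ} (hc : |c| ≤ 1) :
    MemBallZdS a Λ t (c • W) :=
  (h.smul c).mono (mul_le_of_le_one_left ha hc) (mul_le_of_le_one_left hΛ hc)

/-- **THE BALL IS CONVEX**: for `0 ≤ θ ≤ 1`, members `W₁, W₂ ∈ Ball(a, Λ, t)` give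
`θ • W₁ + (1 - θ) • W₂ ∈ Ball(a, Λ, t)`. -/
theorem MemBallZdS.convex (h₁ : MemBallZdS a Λ t W₁) (h₂ : MemBallZdS a Λ t W₂) {θ : ℝ} (h0 : 0 ≤ θ) (h1 : θ ≤ 1) :
    MemBallZdS a Λ t (θ • W₁ + (1 - θ) • W₂) := by
  have h := (h₁.smul θ).add (h₂.smul (1 - θ))
  rw [abs_of_nonneg h0, abs_of_nonneg (by linarith : (0 : ℝ) ≤ 1 - θ)] at h
  refine h.mono (le_of_eq (by ring)) (le_of_eq (by ring))

/-- The corresponding statement for the target type: mass gap on `Ball(a, Λ, t')` implies mass gap on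
`Ball(a', Λ', t)` whenever `a' ≤ a`, `Λ' ≤ Λ`, `t' ≤ t` (bigger loads and weights are harder). -/
theorem MassGapOnBallZdS.mono {β a' Λ' : ℝ} (h : MassGapOnBallZdS d N β a Λ t') (ha : a' ≤ a) (hΛ : Λ' ≤ Λ)
    (ht : t' ≤ t) : MassGapOnBallZdS d N β a' Λ' t :=
  fun W hW => h W ((hW.weight_mono ht).mono ha hΛ)

end Closure

end Summit.Ventures.YMGap.RobustBall
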